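import Mathlib
import HarnessLib
import Summits.Langlands.Statement
import Summits.Langlands.Langlands.Theses.PrimeSwitchSplit
import Summits.Langlands.Langlands.Theses.DepthPrimeSplit
import Summits.Langlands.Langlands.Theses.WeightMultiplicitySplit
import Summits.Langlands.Langlands.Theorems.WeightMultiplicitySplitMinusculeHodgeType
import Literature.NumberTheory.GaloisRepresentations.LabelledHodgeTateWeights
import Literature.NumberTheory.PAdicHodge.FontaineDpst
import Literature.NumberTheory.GaloisRepresentations.LabelledWeightsDeRhamRank
import Literature.NumberTheory.GaloisRepresentations.PadicEmbeddingPlaces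
import Literature.NumberTheory.Automorphic.FontaineMazurGL2WeightOne


/-!
# DepthPrimeSplitClassicalityWeight — Theorems-side twin (PART A) of the lens-2 g17 node `ClassicalityWeightSplit`

Statement-and-kernel support module for stmt-Langlands-25026 (`Summit.Langlands.Langlands.Theses.DepthPrimeSplit.Classicality`, crux rank 5 of
route-Langlands-DepthPrimeSplit rev 0): the Hodge–Tate multiplicity trichotomy (g0's dial BY NAME:
`WeightMultiplicitySplitMinusculeHodgeType.HodgeTateMultLE` / `.IsWallHT`) cuts CLASS EXACTLY into the REGULAR, WALL and DEGENERATE cells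
`RegularClassicality` / `WallClassicality` / `DegenerateClassicality` (each = CLASS's text with ONE dial hypothesis), with kernels:
`classicality_iff_cells` (CLASS ⟺ CG ∧ CW ∧ CD, mod nothing), necessity from the summit (`…_of_langlands`), the FRAME from the host route
(`frame_of_host` through `DepthPrimeSplit.closes`), the deciding theorems `classicality_of_cells` (→ CLASS) and `closes` (→ `_root_.Langlands`),
`langlands_iff_pieces`, and the rank certificates from the tree's `card = n` (`hodgeTateMultLE_rank`, `not_wall_of_rank_le_one`,
`not_degenerate_of_rank_le_two`).  PART B (`DepthPrimeSplitClassicalityWeightLayers`) carries the weight-one box and layer 2.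
Texts ≡ the node ≡ the child-route kit `childroute.items.json` VERBATIM (one generator).  No `sorry`, no new axioms.
-/

set_option linter.dupNamespace false
set_option linter.unusedVariables false

namespace Summit.Langlands.Langlands.Theorems.DepthPrimeSplitClassicalityWeight

open scoped NumberField
open Filter Field IsDedekindDomain
open Literature.NumberTheory.GaloisRepresentations Literature.NumberTheory.Automorphic
open Summit.Langlands.Langlands.Theorems.WeightMultiplicitySplitMinusculeHodgeType (HodgeTateMultLE IsWallHT)

/-! ## 1. Vocabulary (structured forms of the host's clauses — lens-4-g0 VERBATIM — and the dial by name) -/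

section Vocabulary

variable {K : Type} [Field K] [NumberField K] {n : ℕ} {ℓ : ℕ} [Fact ℓ.Prime]

/-- Pinned-geometric (Rec-free): a.e. unramified and de Rham at `v ∣ ℓ` for Fontaine's pinned datum (the host's hypothesis VERBATIM;
definitionally `Summit.Langlands.IsGeometricFramed Rd ρ` for every `Rd`, since `ReciprocityData.pst` is the pinned datum by `rfl`). -/
def IsPinnedGeometric (ρ : FramedGaloisRep K (PadicAlgCl ℓ) n) : Prop :=
  (∀ᶠ v : HeightOneSpectrum (𝓞 K) in cofinite, ρ.IsUnramifiedAt v) ∧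
    ∀ (v : HeightOneSpectrum (𝓞 K)) (hv : ((ℓ : ℕ) : 𝓞 K) ∈ v.asIdeal),
      (Literature.NumberTheory.PAdicHodge.fontainePstAdicCompletion v ℓ hv).IsDeRhamFramed (ρ.toLocal v)

/-- `CloseAt ι π ρ r v` (lens-4-g0 VERBATIM): `π` has a Satake parameter at `v` whose L-normalised arithmetic-Frobenius polynomial is
coefficientwise within ℓ-adic distance `< r` of `charpoly ρ(σ)` for every arithmetic Frobenius `σ` at `v`. -/
def CloseAt {hcpt : isCompact_glFiniteIntegralLevel n K} (ι : PadicAlgCl ℓ ≃+* ℂ) (π : CuspidalAutomorphicRepData n K hcpt)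
    (ρ : FramedGaloisRep K (PadicAlgCl ℓ) n) (r : NNReal) (v : HeightOneSpectrum (𝓞 K)) : Prop :=
  ∃ α : Multiset ℂ, π.1.HasSatakeParamAt v α ∧ ∀ 𝔓 ∈ v.primesAbove, ∀ σ : absoluteGaloisGroup K, IsArithFrobAt (𝓞 K) σ 𝔓 →
    ∀ i : ℕ, Valued.v ((FramedRep.charpoly ρ σ - arithFrobPolyOfSatake ι v.residueCard 1 α).coeff i) < r

/-- PRO-AUTOMORPHIC at fixed tame level (lens-4-g0 VERBATIM): off ONE finite set `S`, Satake-approximable to every ℓ-adic depth. -/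
def IsProAutomorphic (hcpt : isCompact_glFiniteIntegralLevel n K) (ι : PadicAlgCl ℓ ≃+* ℂ) (ρ : FramedGaloisRep K (PadicAlgCl ℓ) n) : Prop :=
  ∃ S : Set (HeightOneSpectrum (𝓞 K)), S.Finite ∧ ∀ r : NNReal, 0 < r →
    ∃ π : CuspidalAutomorphicRepData n K hcpt, π.1.IsLAlgebraic ∧ ∀ v : HeightOneSpectrum (𝓞 K), v ∉ S → CloseAt ι π ρ r v

/-- WEAKLY AUTOMORPHIC (lens-4-g0 VERBATIM): some L-algebraic cuspidal `π` is Satake–Frobenius compatible with `ρ` almost everywhere. -/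
def IsWeaklyAutomorphic (hcpt : isCompact_glFiniteIntegralLevel n K) (ι : PadicAlgCl ℓ ≃+* ℂ) (ρ : FramedGaloisRep K (PadicAlgCl ℓ) n) : Prop :=
  ∃ π : CuspidalAutomorphicRepData n K hcpt, π.1.IsLAlgebraic ∧ ∀ᶠ v : HeightOneSpectrum (𝓞 K) in cofinite, SatakeFrobCompatibleAt ι π.1 ρ v

/-- REGULAR (generic chamber of the dial): every labelled Hodge–Tate weight has multiplicity ≤ 1 — g0's dial BY NAME. -/
abbrev IsHTRegular (ρ : FramedGaloisRep K (PadicAlgCl ℓ) n) : Prop := HodgeTateMultLE 1 ρ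

/-- DEGENERATE chamber: some labelled Hodge–Tate weight has multiplicity ≥ 3 — g0's dial BY NAME. -/
abbrev IsHTDegenerate (ρ : FramedGaloisRep K (PadicAlgCl ℓ) n) : Prop := ¬ HodgeTateMultLE 2 ρ

/-! ### Certificates on the dial -/

/-- multiplicity bounds are monotone in the bound. -/
theorem hodgeTateMultLE_mono {j k : ℕ} (hjk : j ≤ k) {ρ : FramedGaloisRep K (PadicAlgCl ℓ) n} (h : HodgeTateMultLE j ρ) :
    HodgeTateMultLE k ρ :=
  fun v hv τ hτ w => (h v hv τ hτ w).trans hjk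

/-- REGULAR ⟹ all multiplicities ≤ 2 (so REGULAR and WALL are the two chambers of «≤ 2», DEGENERATE the complement). -/
theorem hodgeTateMultLE_two_of_regular {ρ : FramedGaloisRep K (PadicAlgCl ℓ) n} (h : IsHTRegular ρ) : HodgeTateMultLE 2 ρ :=
  hodgeTateMultLE_mono one_le_two h

/-- EXHAUSTIVE: every `ρ` is regular, wall or degenerate. -/
theorem dial_trichotomy (ρ : FramedGaloisRep K (PadicAlgCl ℓ) n) : IsHTRegular ρ ∨ IsWallHT ρ ∨ IsHTDegenerate ρ := by
  by_cases h1 : HodgeTateMultLE 1 ρ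
  · exact Or.inl h1
  · by_cases h2 : HodgeTateMultLE 2 ρ
    · exact Or.inr (Or.inl ⟨h1, h2⟩)
    · exact Or.inr (Or.inr h2)

/-- EXCLUSIVE (three pairwise certificates). -/
theorem dial_exclusive_regular_wall (ρ : FramedGaloisRep K (PadicAlgCl ℓ) n) : ¬ (IsHTRegular ρ ∧ IsWallHT ρ) :=
  fun h => h.2.1 h.1

/-- EXCLUSIVE: regular and degenerate are disjoint chambers. -/
theorem dial_exclusive_regular_degenerate (ρ : FramedGaloisRep K (PadicAlgCl ℓ) n) : ¬ (IsHTRegular ρ ∧ IsHTDegenerate ρ) :=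
  fun h => h.2 (hodgeTateMultLE_two_of_regular h.1)

/-- EXCLUSIVE: wall and degenerate are disjoint chambers. -/
theorem dial_exclusive_wall_degenerate (ρ : FramedGaloisRep K (PadicAlgCl ℓ) n) : ¬ (IsWallHT ρ ∧ IsHTDegenerate ρ) :=
  fun h => h.2 h.1.2

/-- The by-name dial IS g0's born text (route-Langlands-WeightMultiplicitySplit rev 2, generic chamber), with `F ↦ K`. -/
theorem regular_iff_text (ρ : FramedGaloisRep K (PadicAlgCl ℓ) n) : IsHTRegular ρ ↔ (∀ (v : IsDedekindDomain.HeightOneSpectrum (NumberField.RingOfIntegers K)) (hv : ((ℓ : ℕ) : NumberField.RingOfIntegers K) ∈ v.asIdeal) (τ : v.adicCompletion K →+* PadicAlgCl ℓ), Continuous τ → ∀ w : ℤ, (ρ.labelledHodgeTateWeightsAt v (Literature.NumberTheory.PAdicHodge.fontainePstAdicCompletion v ℓ hv).algebra (Literature.NumberTheory.PAdicHodge.fontainePstAdicCompletion v ℓ hv).𝔅 τ).count w ≤ 1) :=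
  Iff.rfl

/-- … and the «≤ 2» clause of the wall / degenerate chambers is g0's born text too. -/
theorem wallLE_iff_text (ρ : FramedGaloisRep K (PadicAlgCl ℓ) n) : HodgeTateMultLE 2 ρ ↔ (∀ (v : IsDedekindDomain.HeightOneSpectrum (NumberField.RingOfIntegers K)) (hv : ((ℓ : ℕ) : NumberField.RingOfIntegers K) ∈ v.asIdeal) (τ : v.adicCompletion K →+* PadicAlgCl ℓ), Continuous τ → ∀ w : ℤ, (ρ.labelledHodgeTateWeightsAt v (Literature.NumberTheory.PAdicHodge.fontainePstAdicCompletion v ℓ hv).algebra (Literature.NumberTheory.PAdicHodge.fontainePstAdicCompletion v ℓ hv).𝔅 τ).count w ≤ 2) :=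
  Iff.rfl

/-- the wall chamber against g0's inlined text (definitional). -/
theorem wall_iff_text (ρ : FramedGaloisRep K (PadicAlgCl ℓ) n) : IsWallHT ρ ↔ (¬ (∀ (v : IsDedekindDomain.HeightOneSpectrum (NumberField.RingOfIntegers K)) (hv : ((ℓ : ℕ) : NumberField.RingOfIntegers K) ∈ v.asIdeal) (τ : v.adicCompletion K →+* PadicAlgCl ℓ), Continuous τ → ∀ w : ℤ, (ρ.labelledHodgeTateWeightsAt v (Literature.NumberTheory.PAdicHodge.fontainePstAdicCompletion v ℓ hv).algebra (Literature.NumberTheory.PAdicHodge.fontainePstAdicCompletion v ℓ hv).𝔅 τ).count w ≤ 1) ∧ (∀ (v : IsDedekindDomain.HeightOneSpectrum (NumberField.RingOfIntegers K)) (hv : ((ℓ : ℕ) : NumberField.RingOfIntegers K) ∈ v.asIdeal) (τ : v.adicCompletion K →+* PadicAlgCl ℓ), Continuous τ → ∀ w : ℤ, (ρ.labelledHodgeTateWeightsAt v (Literature.NumberTheory.PAdicHodge.fontainePstAdicCompletion v ℓ hv).algebra (Literature.NumberTheory.PAdicHodge.fontainePstAdicCompletion v ℓ hv).𝔅 τ).count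 w ≤ 2)) :=
  Iff.rfl

/-- the degenerate chamber against g0's inlined text (definitional). -/
theorem degenerate_iff_text (ρ : FramedGaloisRep K (PadicAlgCl ℓ) n) : IsHTDegenerate ρ ↔ ¬ (∀ (v : IsDedekindDomain.HeightOneSpectrum (NumberField.RingOfIntegers K)) (hv : ((ℓ : ℕ) : NumberField.RingOfIntegers K) ∈ v.asIdeal) (τ : v.adicCompletion K →+* PadicAlgCl ℓ), Continuous τ → ∀ w : ℤ, (ρ.labelledHodgeTateWeightsAt v (Literature.NumberTheory.PAdicHodge.fontainePstAdicCompletion v ℓ hv).algebra (Literature.NumberTheory.PAdicHodge.fontainePstAdicCompletion v ℓ hv).𝔅 τ).count w ≤ 2) :=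
  Iff.rfl

/-- A multiplicity never exceeds the number of labelled weights: if every labelled Hodge–Tate multiset of `ρ` has at most `k` elements then
`HodgeTateMultLE k ρ` — so the DEGENERATE chamber is EMPTY wherever all labelled multisets have ≤ 2 elements (on paper: all of rank ≤ 2,
where `card = n`; the tree's pinned datum does not record `card = n`, hence the hypothesis). -/
theorem hodgeTateMultLE_of_card_le {k : ℕ} {ρ : FramedGaloisRep K (PadicAlgCl ℓ) n}
    (h : ∀ (v : HeightOneSpectrum (𝓞 K)) (hv : ((ℓ : ℕ) : 𝓞 K) ∈ v.asIdeal) (τ : v.adicCompletion K →+* PadicAlgCl ℓ), Continuous τ →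
      Multiset.card (ρ.labelledHodgeTateWeightsAt v (Literature.NumberTheory.PAdicHodge.fontainePstAdicCompletion v ℓ hv).algebra
        (Literature.NumberTheory.PAdicHodge.fontainePstAdicCompletion v ℓ hv).𝔅 τ) ≤ k) :
    HodgeTateMultLE k ρ :=
  fun v hv τ hτ w => (Multiset.count_le_card w _).trans (h v hv τ hτ)

/-- all labelled multisets of size ≤ 2 ⟹ not degenerate. -/
theorem not_degenerate_of_card_le_two {ρ : FramedGaloisRep K (PadicAlgCl ℓ) n}
    (h : ∀ (v : HeightOneSpectrum (𝓞 K)) (hv : ((ℓ : ℕ) : 𝓞 K) ∈ v.asIdeal) (τ : v.adicCompletion K →+* PadicAlgCl ℓ), Continuous τ →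
      Multiset.card (ρ.labelledHodgeTateWeightsAt v (Literature.NumberTheory.PAdicHodge.fontainePstAdicCompletion v ℓ hv).algebra
        (Literature.NumberTheory.PAdicHodge.fontainePstAdicCompletion v ℓ hv).𝔅 τ) ≤ 2) :
    ¬ IsHTDegenerate ρ :=
  fun hd => hd (hodgeTateMultLE_of_card_le h)

/-- WEIGHT-ONE multiset certificate: `{0,0}` has a weight of multiplicity 2 and none of multiplicity 3. -/
theorem count_pair_zero : ({0, 0} : Multiset ℤ).count 0 = 2 ∧ ∀ w : ℤ, ({0, 0} : Multiset ℤ).count w ≤ 2 := by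
  refine ⟨by decide, fun w => ?_⟩
  exact (Multiset.count_le_card w _).trans (by simp)

/-- Every rational prime lies under some finite place (going up along `ℤ → 𝓞 K`). -/
theorem exists_heightOneSpectrum_natCast_mem (K : Type) [Field K] [NumberField K] (p : ℕ) [hp : Fact p.Prime] :
    ∃ w : HeightOneSpectrum (𝓞 K), ((p : ℕ) : 𝓞 K) ∈ w.asIdeal := by
  haveI hmax : (Ideal.span {(p : ℤ)}).IsMaximal :=
    PrincipalIdealRing.isMaximal_of_irreducible (Nat.prime_iff_prime_int.mp hp.out).irreducible
  obtain ⟨Q, hQmax, hQ⟩ := Ideal.exists_ideal_over_maximal_of_isIntegral (S := 𝓞 K)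
    (Ideal.span {(p : ℤ)}) (by
      rw [(RingHom.injective_iff_ker_eq_bot _).mp (algebraMap ℤ (𝓞 K)).injective_int]
      exact bot_le)
  have hpQ : ((p : ℕ) : 𝓞 K) ∈ Q := by
    have : (p : ℤ) ∈ Q.comap (algebraMap ℤ (𝓞 K)) := by
      rw [hQ]; exact Ideal.mem_span_singleton_self _
    simpa [Ideal.mem_comap] using this
  have hQne : Q ≠ ⊥ := by
    intro hbot
    rw [hbot, Ideal.mem_bot] at hpQ
    exact (Nat.cast_ne_zero.mpr hp.out.ne_zero) hpQ
  exact ⟨⟨Q, hQmax.isPrime, hQne⟩, hpQ⟩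

/-- A LABELLED PLACE above `ℓ` always exists: a place `v ∣ ℓ` of `K` and a continuous `τ : K_v →+* ℚ̄_ℓ`
(tree: `PadicEmbedding.exists_continuous_ringHom_adicCompletion`).  So the dial is never read on an empty index set. -/
theorem exists_labelledPlace (K : Type) [Field K] [NumberField K] (ℓ : ℕ) [Fact ℓ.Prime] :
    ∃ (v : HeightOneSpectrum (𝓞 K)) (hv : ((ℓ : ℕ) : 𝓞 K) ∈ v.asIdeal) (τ : v.adicCompletion K →+* PadicAlgCl ℓ), Continuous τ := by
  obtain ⟨v, hv⟩ := exists_heightOneSpectrum_natCast_mem K ℓ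
  obtain ⟨τ, hτ⟩ := PadicEmbedding.exists_continuous_ringHom_adicCompletion (p := ℓ) v hv
  exact ⟨v, hv, τ, hτ⟩

/-- RANK BOUND (tree theorem `FramedGaloisRep.card_labelledHodgeTateWeightsAt_eq_of_isDeRhamFramed`: a representation de Rham for the pinned
datum has exactly `n` labelled weights at every label): a pinned-geometric `ρ` of rank `n` has every labelled multiplicity ≤ n. -/
theorem hodgeTateMultLE_rank {ρ : FramedGaloisRep K (PadicAlgCl ℓ) n} (hgeo : IsPinnedGeometric ρ) : HodgeTateMultLE n ρ :=
  hodgeTateMultLE_of_card_le fun v hv τ hτ =>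
    (FramedGaloisRep.card_labelledHodgeTateWeightsAt_eq_of_isDeRhamFramed ρ v hv (hgeo.2 v hv) τ hτ).le

/-- Rank ≤ 1: REGULAR (so the wall and degenerate chambers are EMPTY in rank ≤ 1). -/
theorem regular_of_rank_le_one {ρ : FramedGaloisRep K (PadicAlgCl ℓ) n} (hn : n ≤ 1) (hgeo : IsPinnedGeometric ρ) : IsHTRegular ρ :=
  hodgeTateMultLE_mono hn (hodgeTateMultLE_rank hgeo)

/-- Rank ≤ 1: NOT of wall type (the wall chamber is EMPTY in rank ≤ 1). -/
theorem not_wall_of_rank_le_one {ρ : FramedGaloisRep K (PadicAlgCl ℓ) n} (hn : n ≤ 1) (hgeo : IsPinnedGeometric ρ) : ¬ IsWallHT ρ :=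
  fun hw => hw.1 (regular_of_rank_le_one hn hgeo)

/-- Rank ≤ 2: NOT DEGENERATE (the degenerate chamber is EMPTY in rank ≤ 2 — kernel, not just on paper). -/
theorem not_degenerate_of_rank_le_two {ρ : FramedGaloisRep K (PadicAlgCl ℓ) n} (hn : n ≤ 2) (hgeo : IsPinnedGeometric ρ) :
    ¬ IsHTDegenerate ρ :=
  fun hd => hd (hodgeTateMultLE_mono hn (hodgeTateMultLE_rank hgeo))

/-- If the labelled Hodge–Tate weights of `ρ` are `{0,0}` at every labelled place above `ℓ` (Pan's «Hodge–Tate of weights 0,0», the tree's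
`IsDeRhamWeightZeroGL2`-shape clause) then `ρ` is of WALL type (a labelled place exists by `exists_labelledPlace`). -/
theorem isWallHT_of_weights_eq_pair {ρ : FramedGaloisRep K (PadicAlgCl ℓ) n}
    (h : ∀ (v : HeightOneSpectrum (𝓞 K)) (hv : ((ℓ : ℕ) : 𝓞 K) ∈ v.asIdeal) (τ : v.adicCompletion K →+* PadicAlgCl ℓ), Continuous τ →
      ρ.labelledHodgeTateWeightsAt v (Literature.NumberTheory.PAdicHodge.fontainePstAdicCompletion v ℓ hv).algebra
        (Literature.NumberTheory.PAdicHodge.fontainePstAdicCompletion v ℓ hv).𝔅 τ = {0, 0}) :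
    IsWallHT ρ := by
  refine ⟨fun hreg => ?_, fun v hv τ hτ w => ?_⟩
  · obtain ⟨v, hv, τ, hτ⟩ := exists_labelledPlace K ℓ
    have h1 := hreg v hv τ hτ 0
    rw [h v hv τ hτ, count_pair_zero.1] at h1
    omega
  · rw [h v hv τ hτ]
    exact count_pair_zero.2 w

/-- Hodge–Tate ISOTYPIC (the degenerate chamber's first sub-dial): every labelled weight multiset is constant — Artin type up to a labelled twist. -/
def IsHTIsotypic (ρ : FramedGaloisRep K (PadicAlgCl ℓ) n) : Prop :=
  ∀ (v : HeightOneSpectrum (𝓞 K)) (hv : ((ℓ : ℕ) : 𝓞 K) ∈ v.asIdeal) (τ : v.adicCompletion K →+* PadicAlgCl ℓ), Continuous τ →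
    ∃ a : ℤ, ∀ w ∈ ρ.labelledHodgeTateWeightsAt v (Literature.NumberTheory.PAdicHodge.fontainePstAdicCompletion v ℓ hv).algebra
      (Literature.NumberTheory.PAdicHodge.fontainePstAdicCompletion v ℓ hv).𝔅 τ, w = a

/-- the isotypic sub-dial against its inlined text (definitional). -/
theorem isHTIsotypic_iff_text (ρ : FramedGaloisRep K (PadicAlgCl ℓ) n) : IsHTIsotypic ρ ↔ (∀ (v : IsDedekindDomain.HeightOneSpectrum (NumberField.RingOfIntegers K)) (hv : ((ℓ : ℕ) : NumberField.RingOfIntegers K) ∈ v.asIdeal) (τ : v.adicCompletion K →+* PadicAlgCl ℓ), Continuous τ → ∃ a : ℤ, ∀ w ∈ ρ.labelledHodgeTateWeightsAt v (Literature.NumberTheory.PAdicHodge.fontainePstAdicCompletion v ℓ hv).algebra (Literature.NumberTheory.PAdicHodge.fontainePstAdicCompletion v ℓ hv).𝔅 τ, w = a) :=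
  Iff.rfl

end Vocabulary

/-! ## 2. The target BY NAME and its text -/

/-- CLASS's born text (tree, rev 0) in the structured vocabulary — definitional. -/
theorem target_iff : Summit.Langlands.Langlands.Theses.DepthPrimeSplit.Classicality ↔
    ∀ (K : Type) [Field K] [NumberField K] (n : ℕ) (hcpt : isCompact_glFiniteIntegralLevel n K), 0 < n →
      ∀ (ℓ : ℕ) [Fact ℓ.Prime] (ι : PadicAlgCl ℓ ≃+* ℂ) (ρ : FramedGaloisRep K (PadicAlgCl ℓ) n),
        ρ.toGaloisRep.IsIrreducible → IsPinnedGeometric ρ → IsProAutomorphic hcpt ι ρ → IsWeaklyAutomorphic hcpt ι ρ :=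
  Iff.rfl

/-- … and as the inlined one-liner of record (stmt-Langlands-25026). -/
theorem target_text_iff : Summit.Langlands.Langlands.Theses.DepthPrimeSplit.Classicality ↔ ∀ (K : Type) [Field K] [NumberField K] (n : ℕ) (hcpt : Literature.NumberTheory.Automorphic.isCompact_glFiniteIntegralLevel n K), 0 < n → ∀ (ℓ : ℕ) [Fact ℓ.Prime] (ι : PadicAlgCl ℓ ≃+* ℂ) (ρ : Literature.NumberTheory.GaloisRepresentations.FramedGaloisRep K (PadicAlgCl ℓ) n), ρ.toGaloisRep.IsIrreducible → ((∀ᶠ v : IsDedekindDomain.HeightOneSpectrum (NumberField.RingOfIntegers K) in cofinite, ρ.IsUnramifiedAt v) ∧ ∀ (v : IsDedekindDomain.HeightOneSpectrum (NumberField.RingOfIntegers K)) (hv : ((ℓ : ℕ) : NumberField.RingOfIntegers K) ∈ v.asIdeal), (Literature.NumberTheory.PAdicHodge.fontainePstAdicCompletion v ℓ hv).IsDeRhamFramed (ρ.toLocal v)) → (∃ S : Set (IsDedekindDomain.HeightOneSpectrum (NumberField.RingOfIntegers K)), S.Finite ∧ ∀ r : NNReal, 0 < r → ∃ π : Literature.NumberTheory.Automorphic.CuspidalAutomorphicRepData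 n K hcpt, π.1.IsLAlgebraic ∧ ∀ v : IsDedekindDomain.HeightOneSpectrum (NumberField.RingOfIntegers K), v ∉ S → (∃ α : Multiset ℂ, π.1.HasSatakeParamAt v α ∧ ∀ 𝔓 ∈ v.primesAbove, ∀ σ : Field.absoluteGaloisGroup K, IsArithFrobAt (NumberField.RingOfIntegers K) σ 𝔓 → ∀ i : ℕ, Valued.v ((Literature.NumberTheory.GaloisRepresentations.FramedRep.charpoly ρ σ - Literature.NumberTheory.Automorphic.arithFrobPolyOfSatake ι v.residueCard 1 α).coeff i) < r)) → ∃ π : Literature.NumberTheory.Automorphic.CuspidalAutomorphicRepData n K hcpt, π.1.IsLAlgebraic ∧ ∀ᶠ v : IsDedekindDomain.HeightOneSpectrum (NumberField.RingOfIntegers K) in cofinite, SatakeFrobCompatibleAt ι π.1 ρ v :=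
  Iff.rfl

/-! ## 3. The cells (items of the child route; inlined one-liners = CLASS's text + ONE hypothesis) and the FRAME -/

/-- CG · REGULAR CLASSICALITY · crux rank 3 · ATTACKABLE (print sectors) · WEAKER.
CLASS for `ρ` whose labelled Hodge–Tate weights are multiplicity-free at every `v ∣ ℓ` («de Rham points of regular weight on the
eigenvariety / in the completed Hecke algebra are classical»: Kisin 2003; Emerton 2011 Thm 1.2.4; Pan II = tree fact
`Literature.NumberTheory.Automorphic.Pan2022_proModularDeRhamClassical_GL2Q` (GL₂/ℚ, every p, ρ̄ abs. irreducible); Breuil–Hellmann–Schraen 2019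
(crystalline generic points of definite unitary eigenvarieties); Breuil–Ding 2023; Jiang 2026 arXiv:2605.18426 (Hilbert, T-regular)). -/
def RegularClassicality : Prop :=
  ∀ (K : Type) [Field K] [NumberField K] (n : ℕ) (hcpt : Literature.NumberTheory.Automorphic.isCompact_glFiniteIntegralLevel n K), 0 < n → ∀ (ℓ : ℕ) [Fact ℓ.Prime] (ι : PadicAlgCl ℓ ≃+* ℂ) (ρ : Literature.NumberTheory.GaloisRepresentations.FramedGaloisRep K (PadicAlgCl ℓ) n), ρ.toGaloisRep.IsIrreducible → ((∀ᶠ v : IsDedekindDomain.HeightOneSpectrum (NumberField.RingOfIntegers K) in cofinite, ρ.IsUnramifiedAt v) ∧ ∀ (v : IsDedekindDomain.HeightOneSpectrum (NumberField.RingOfIntegers K)) (hv : ((ℓ : ℕ) : NumberField.RingOfIntegers K) ∈ v.asIdeal), (Literature.NumberTheory.PAdicHodge.fontainePstAdicCompletion v ℓ hv).IsDeRhamFramed (ρ.toLocal v)) → Summit.Langlands.Langlands.Theorems.WeightMultiplicitySplitMinusculeHodgeType.HodgeTateMultLE 1 ρ → (∃ S : Set (IsDedekindDomain.HeightOneSpectrum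 (NumberField.RingOfIntegers K)), S.Finite ∧ ∀ r : NNReal, 0 < r → ∃ π : Literature.NumberTheory.Automorphic.CuspidalAutomorphicRepData n K hcpt, π.1.IsLAlgebraic ∧ ∀ v : IsDedekindDomain.HeightOneSpectrum (NumberField.RingOfIntegers K), v ∉ S → (∃ α : Multiset ℂ, π.1.HasSatakeParamAt v α ∧ ∀ 𝔓 ∈ v.primesAbove, ∀ σ : Field.absoluteGaloisGroup K, IsArithFrobAt (NumberField.RingOfIntegers K) σ 𝔓 → ∀ i : ℕ, Valued.v ((Literature.NumberTheory.GaloisRepresentations.FramedRep.charpoly ρ σ - Literature.NumberTheory.Automorphic.arithFrobPolyOfSatake ι v.residueCard 1 α).coeff i) < r)) → ∃ π : Literature.NumberTheory.Automorphic.CuspidalAutomorphicRepData n K hcpt, π.1.IsLAlgebraic ∧ ∀ᶠ v : IsDedekindDomain.HeightOneSpectrum (NumberField.RingOfIntegers K) in cofinite, SatakeFrobCompatibleAt ι π.1 ρ v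

/-- CW · WALL CLASSICALITY · crux rank 2 · the conjunct this route ATTACKS · ATTACKABLE (n = 2 weight one over ℚ: Pan 2022 FMPi Thm 1.0.4,
Buzzard–Taylor 1999, Pilloni–Stroh 2016; totally real: Kassaei 2016, Pilloni 2017, Sasaki 2019; n = 4 {0,0,1,1} ordinary: Boxer–Calegari–Gee–
Pilloni 2025 arXiv:2502.20645) · INSTRUMENTABLE on Shimura-coherent wall types (higher Coleman / Hida theory, geometric Sen theory) · WEAKER.
CLASS for `ρ` of WALL Hodge–Tate type (all labelled multiplicities ≤ 2, some = 2). -/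
def WallClassicality : Prop :=
  ∀ (K : Type) [Field K] [NumberField K] (n : ℕ) (hcpt : Literature.NumberTheory.Automorphic.isCompact_glFiniteIntegralLevel n K), 0 < n → ∀ (ℓ : ℕ) [Fact ℓ.Prime] (ι : PadicAlgCl ℓ ≃+* ℂ) (ρ : Literature.NumberTheory.GaloisRepresentations.FramedGaloisRep K (PadicAlgCl ℓ) n), ρ.toGaloisRep.IsIrreducible → ((∀ᶠ v : IsDedekindDomain.HeightOneSpectrum (NumberField.RingOfIntegers K) in cofinite, ρ.IsUnramifiedAt v) ∧ ∀ (v : IsDedekindDomain.HeightOneSpectrum (NumberField.RingOfIntegers K)) (hv : ((ℓ : ℕ) : NumberField.RingOfIntegers K) ∈ v.asIdeal), (Literature.NumberTheory.PAdicHodge.fontainePstAdicCompletion v ℓ hv).IsDeRhamFramed (ρ.toLocal v)) → Summit.Langlands.Langlands.Theorems.WeightMultiplicitySplitMinusculeHodgeType.IsWallHT ρ → (∃ S : Set (IsDedekindDomain.HeightOneSpectrum (NumberField.RingOfIntegers K)), S.Finite ∧ ∀ r : NNReal, 0 < r → ∃ π : Literature.NumberTheory.Automorphic.CuspidalAutomorphicRepData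 n K hcpt, π.1.IsLAlgebraic ∧ ∀ v : IsDedekindDomain.HeightOneSpectrum (NumberField.RingOfIntegers K), v ∉ S → (∃ α : Multiset ℂ, π.1.HasSatakeParamAt v α ∧ ∀ 𝔓 ∈ v.primesAbove, ∀ σ : Field.absoluteGaloisGroup K, IsArithFrobAt (NumberField.RingOfIntegers K) σ 𝔓 → ∀ i : ℕ, Valued.v ((Literature.NumberTheory.GaloisRepresentations.FramedRep.charpoly ρ σ - Literature.NumberTheory.Automorphic.arithFrobPolyOfSatake ι v.residueCard 1 α).coeff i) < r)) → ∃ π : Literature.NumberTheory.Automorphic.CuspidalAutomorphicRepData n K hcpt, π.1.IsLAlgebraic ∧ ∀ᶠ v : IsDedekindDomain.HeightOneSpectrum (NumberField.RingOfIntegers K) in cofinite, SatakeFrobCompatibleAt ι π.1 ρ v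

/-- CD · DEGENERATE CLASSICALITY · crux rank 4 · DECLARED RESIDUAL · BARRIER (`NonRegularWeightBarrierNarrow`, residual clause: no Hodge–Tate
period-map / Shimura realisation carries a weight of multiplicity ≥ 3; Goldring–Koskivirta) · WEAKER.
CLASS for `ρ` with some labelled Hodge–Tate weight of multiplicity ≥ 3 (Artin type in rank ≥ 3, large isotypic blocks). -/
def DegenerateClassicality : Prop :=
  ∀ (K : Type) [Field K] [NumberField K] (n : ℕ) (hcpt : Literature.NumberTheory.Automorphic.isCompact_glFiniteIntegralLevel n K), 0 < n → ∀ (ℓ : ℕ) [Fact ℓ.Prime] (ι : PadicAlgCl ℓ ≃+* ℂ) (ρ : Literature.NumberTheory.GaloisRepresentations.FramedGaloisRep K (PadicAlgCl ℓ) n), ρ.toGaloisRep.IsIrreducible → ((∀ᶠ v : IsDedekindDomain.HeightOneSpectrum (NumberField.RingOfIntegers K) in cofinite, ρ.IsUnramifiedAt v) ∧ ∀ (v : IsDedekindDomain.HeightOneSpectrum (NumberField.RingOfIntegers K)) (hv : ((ℓ : ℕ) : NumberField.RingOfIntegers K) ∈ v.asIdeal), (Literature.NumberTheory.PAdicHodge.fontainePstAdicCompletion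 v ℓ hv).IsDeRhamFramed (ρ.toLocal v)) → ¬ Summit.Langlands.Langlands.Theorems.WeightMultiplicitySplitMinusculeHodgeType.HodgeTateMultLE 2 ρ → (∃ S : Set (IsDedekindDomain.HeightOneSpectrum (NumberField.RingOfIntegers K)), S.Finite ∧ ∀ r : NNReal, 0 < r → ∃ π : Literature.NumberTheory.Automorphic.CuspidalAutomorphicRepData n K hcpt, π.1.IsLAlgebraic ∧ ∀ v : IsDedekindDomain.HeightOneSpectrum (NumberField.RingOfIntegers K), v ∉ S → (∃ α : Multiset ℂ, π.1.HasSatakeParamAt v α ∧ ∀ 𝔓 ∈ v.primesAbove, ∀ σ : Field.absoluteGaloisGroup K, IsArithFrobAt (NumberField.RingOfIntegers K) σ 𝔓 → ∀ i : ℕ, Valued.v ((Literature.NumberTheory.GaloisRepresentations.FramedRep.charpoly ρ σ - Literature.NumberTheory.Automorphic.arithFrobPolyOfSatake ι v.residueCard 1 α).coeff i) < r)) → ∃ π : Literature.NumberTheory.Automorphic.CuspidalAutomorphicRepData n K hcpt, π.1.IsLAlgebraic ∧ ∀ᶠ v : IsDedekindDomain.HeightOneSpectrum (NumberField.RingOfIntegers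 K) in cofinite, SatakeFrobCompatibleAt ι π.1 ρ v

/-- FRAME · support rank 9 · content = the HOST ROUTE around CLASS, as ONE implication BY NAME: route-Langlands-DepthPrimeSplit rev 0 with CLASS
discharged — DyadicSeed 25023 · OddPrimeSeed 25025 · FernSpread 25024 · W⁺ 17415 · P 17534 · L∤R 18084 · CRD 17930 (`frame_of_host`). -/
def ClassicalityFrame : Prop :=
  Summit.Langlands.Langlands.Theses.DepthPrimeSplit.Classicality → _root_.Langlands

/-- ASSEMBLY · the curried form of `closes` (order-free, pure logic). -/
def Assembly : Prop :=
  RegularClassicality → WallClassicality → DegenerateClassicality → ClassicalityFrame → _root_.Langlands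

/-! ### The cells in the structured vocabulary (definitional) -/

/-- CG in the structured vocabulary (definitional). -/
theorem regularClassicality_iff : RegularClassicality ↔
    ∀ (K : Type) [Field K] [NumberField K] (n : ℕ) (hcpt : isCompact_glFiniteIntegralLevel n K), 0 < n →
      ∀ (ℓ : ℕ) [Fact ℓ.Prime] (ι : PadicAlgCl ℓ ≃+* ℂ) (ρ : FramedGaloisRep K (PadicAlgCl ℓ) n),
        ρ.toGaloisRep.IsIrreducible → IsPinnedGeometric ρ → IsHTRegular ρ → IsProAutomorphic hcpt ι ρ → IsWeaklyAutomorphic hcpt ι ρ :=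
  Iff.rfl

/-- CW in the structured vocabulary (definitional). -/
theorem wallClassicality_iff : WallClassicality ↔
    ∀ (K : Type) [Field K] [NumberField K] (n : ℕ) (hcpt : isCompact_glFiniteIntegralLevel n K), 0 < n →
      ∀ (ℓ : ℕ) [Fact ℓ.Prime] (ι : PadicAlgCl ℓ ≃+* ℂ) (ρ : FramedGaloisRep K (PadicAlgCl ℓ) n),
        ρ.toGaloisRep.IsIrreducible → IsPinnedGeometric ρ → IsWallHT ρ → IsProAutomorphic hcpt ι ρ → IsWeaklyAutomorphic hcpt ι ρ :=
  Iff.rfl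

/-- CD in the structured vocabulary (definitional). -/
theorem degenerateClassicality_iff : DegenerateClassicality ↔
    ∀ (K : Type) [Field K] [NumberField K] (n : ℕ) (hcpt : isCompact_glFiniteIntegralLevel n K), 0 < n →
      ∀ (ℓ : ℕ) [Fact ℓ.Prime] (ι : PadicAlgCl ℓ ≃+* ℂ) (ρ : FramedGaloisRep K (PadicAlgCl ℓ) n),
        ρ.toGaloisRep.IsIrreducible → IsPinnedGeometric ρ → IsHTDegenerate ρ → IsProAutomorphic hcpt ι ρ → IsWeaklyAutomorphic hcpt ι ρ :=
  Iff.rfl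

/-- FRAME in the structured vocabulary (definitional). -/
theorem classicalityFrame_iff : ClassicalityFrame ↔ (Summit.Langlands.Langlands.Theses.DepthPrimeSplit.Classicality → _root_.Langlands) :=
  Iff.rfl

/-! ## 4. EXACTNESS: `CLASS ⟺ CG ∧ CW ∧ CD` (mod nothing) -/

/-- CLASS ⟹ CG (restriction to the regular chamber). -/
theorem regular_of_classicality (h : Summit.Langlands.Langlands.Theses.DepthPrimeSplit.Classicality) : RegularClassicality :=
  fun K _ _ n hcpt hn ℓ _ ι ρ hirr hgeo _ hpro => h K n hcpt hn ℓ ι ρ hirr hgeo hpro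

/-- CLASS ⟹ CW (restriction to the wall chamber). -/
theorem wall_of_classicality (h : Summit.Langlands.Langlands.Theses.DepthPrimeSplit.Classicality) : WallClassicality :=
  fun K _ _ n hcpt hn ℓ _ ι ρ hirr hgeo _ hpro => h K n hcpt hn ℓ ι ρ hirr hgeo hpro

/-- CLASS ⟹ CD (restriction to the degenerate chamber). -/
theorem degenerate_of_classicality (h : Summit.Langlands.Langlands.Theses.DepthPrimeSplit.Classicality) : DegenerateClassicality :=
  fun K _ _ n hcpt hn ℓ _ ι ρ hirr hgeo _ hpro => h K n hcpt hn ℓ ι ρ hirr hgeo hpro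

/-- GLUE of the split (excluded middle on the dial, twice). -/
theorem classicality_of_cells (hG : RegularClassicality) (hW : WallClassicality) (hD : DegenerateClassicality) :
    Summit.Langlands.Langlands.Theses.DepthPrimeSplit.Classicality := by
  intro K _ _ n hcpt hn ℓ _ ι ρ hirr hgeo hpro
  rcases dial_trichotomy ρ with h1 | h2 | h3
  · exact hG K n hcpt hn ℓ ι ρ hirr hgeo h1 hpro
  · exact hW K n hcpt hn ℓ ι ρ hirr hgeo h2 hpro
  · exact hD K n hcpt hn ℓ ι ρ hirr hgeo h3 hpro

/-- EXACTNESS of the node. -/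
theorem classicality_iff_cells : Summit.Langlands.Langlands.Theses.DepthPrimeSplit.Classicality ↔ RegularClassicality ∧ WallClassicality ∧ DegenerateClassicality :=
  ⟨fun h => ⟨regular_of_classicality h, wall_of_classicality h, degenerate_of_classicality h⟩,
    fun h => classicality_of_cells h.1 h.2.1 h.2.2⟩

/-! ## 5. NECESSITY: every piece is implied by the summit -/

/-- `Langlands ⟹ B_w` (projection of clause (B); `ReciprocityData.pst` is Fontaine's pinned datum by `rfl`) — lens-4-g0's kernel. -/
theorem weak_of_langlands (hL : _root_.Langlands) : Summit.Langlands.Langlands.Theses.PrimeSwitchSplit.WeakGeometricAutomorphy := by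
  intro K _ _ n hcpt hn ℓ _ ι ρ hirr hgeo
  obtain ⟨⟨Rec⟩, h⟩ := hL K
  obtain ⟨π, hπ, hcorr⟩ := (h Rec n hn hcpt).2 ℓ ι ρ hirr ⟨hgeo.1, fun v hv => hgeo.2 v hv⟩
  exact ⟨π, hπ, hcorr.1⟩

/-- `B_w ⟹ CLASS` (drop the pro-automorphy hypothesis). -/
theorem classicality_of_weak (h : Summit.Langlands.Langlands.Theses.PrimeSwitchSplit.WeakGeometricAutomorphy) : Summit.Langlands.Langlands.Theses.DepthPrimeSplit.Classicality :=
  fun K _ _ n hcpt hn ℓ _ ι ρ hirr hgeo _ => h K n hcpt hn ℓ ι ρ hirr hgeo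

/-- NECESSITY: the summit implies CLASS (through weak automorphy of geometric irreducibles). -/
theorem classicality_of_langlands (hL : _root_.Langlands) : Summit.Langlands.Langlands.Theses.DepthPrimeSplit.Classicality :=
  classicality_of_weak (weak_of_langlands hL)

/-- NECESSITY: the summit implies CG. -/
theorem regular_of_langlands (hL : _root_.Langlands) : RegularClassicality :=
  regular_of_classicality (classicality_of_langlands hL)

/-- NECESSITY: the summit implies CW. -/
theorem wall_of_langlands (hL : _root_.Langlands) : WallClassicality :=
  wall_of_classicality (classicality_of_langlands hL)

/-- NECESSITY: the summit implies CD. -/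
theorem degenerate_of_langlands (hL : _root_.Langlands) : DegenerateClassicality :=
  degenerate_of_classicality (classicality_of_langlands hL)

/-- NECESSITY: the summit implies the FRAME (trivially). -/
theorem frame_of_langlands (hL : _root_.Langlands) : ClassicalityFrame :=
  fun _ => hL

/-! ## 6. The FRAME from the host route BY NAME -/

/-- FRAME ⟸ the host route's other seven items (route-Langlands-DepthPrimeSplit rev 0 `closes`, CLASS abstracted). -/
theorem frame_of_host (hD : Summit.Langlands.Langlands.Theses.DepthPrimeSplit.DyadicSeed) (hO : Summit.Langlands.Langlands.Theses.DepthPrimeSplit.OddPrimeSeed) (hF : Summit.Langlands.Langlands.Theses.DepthPrimeSplit.FernSpread)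
    (hW : Summit.Langlands.Langlands.Theses.DepthPrimeSplit.SatakeAvatarExistence) (hP : Summit.Langlands.Langlands.Theses.DepthPrimeSplit.PadicMemberCompatibility)
    (hA : Summit.Langlands.Langlands.Theses.DepthPrimeSplit.CompatibilityAwayFromLR) (hR : Summit.Langlands.Langlands.Theses.DepthPrimeSplit.CanonicalReciprocityData) : ClassicalityFrame :=
  fun hC => Summit.Langlands.Langlands.Theses.DepthPrimeSplit.closes hD hO hF hC hW hP hA hR

/-! ## 7. DECIDING THEOREM and the root identity -/

/-- DECIDING THEOREM of the node (= the child route's glue VERBATIM up to names): the three cells and the frame ⟹ Langlands.  Four binders,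
all load-bearing; `Assembly` pulled into the cone by the writer convention. -/
theorem closes (hG : RegularClassicality) (hW : WallClassicality) (hD : DegenerateClassicality) (hF : ClassicalityFrame) :
    _root_.Langlands := by
  suffices hAsm : Assembly from hAsm hG hW hD hF
  intro hG hW hD hF
  exact hF (classicality_of_cells hG hW hD)

/-- The same through the host's leaves (ten binders: the three cells + the host's seven other items). -/
theorem closes_host_leaves (hG : RegularClassicality) (hW : WallClassicality) (hDg : DegenerateClassicality)
    (hD : Summit.Langlands.Langlands.Theses.DepthPrimeSplit.DyadicSeed) (hO : Summit.Langlands.Langlands.Theses.DepthPrimeSplit.OddPrimeSeed) (hF : Summit.Langlands.Langlands.Theses.DepthPrimeSplit.FernSpread)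
    (hWp : Summit.Langlands.Langlands.Theses.DepthPrimeSplit.SatakeAvatarExistence) (hP : Summit.Langlands.Langlands.Theses.DepthPrimeSplit.PadicMemberCompatibility)
    (hA : Summit.Langlands.Langlands.Theses.DepthPrimeSplit.CompatibilityAwayFromLR) (hR : Summit.Langlands.Langlands.Theses.DepthPrimeSplit.CanonicalReciprocityData) : _root_.Langlands :=
  closes hG hW hDg (frame_of_host hD hO hF hWp hP hA hR)

/-- ROOT IDENTITY: `Langlands ⟺ CG ∧ CW ∧ CD ∧ FRAME`. -/
theorem langlands_iff_pieces : _root_.Langlands ↔ RegularClassicality ∧ WallClassicality ∧ DegenerateClassicality ∧ ClassicalityFrame :=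
  ⟨fun hL => ⟨regular_of_langlands hL, wall_of_langlands hL, degenerate_of_langlands hL, frame_of_langlands hL⟩,
    fun h => closes h.1 h.2.1 h.2.2.1 h.2.2.2⟩

/-- … and against lens-4's own exactness: `Langlands ⟺ (B_w-pieces of the host with CLASS split) ∧ FRAME`-shape reading:
`CLASS ∧ FRAME ⟺ Langlands`. -/
theorem langlands_iff_class_and_frame : _root_.Langlands ↔ Summit.Langlands.Langlands.Theses.DepthPrimeSplit.Classicality ∧ ClassicalityFrame :=
  ⟨fun hL => ⟨classicality_of_langlands hL, frame_of_langlands hL⟩, fun h => h.2 h.1⟩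

end Summit.Langlands.Langlands.Theorems.DepthPrimeSplitClassicalityWeight
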